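import Summits.CriticalPhenomena.PercolationContinuityZ3.Theorems.PercNearOneGluingNoHeavyConstsSingleEdgeChainRuleSEE
import Summits.CriticalPhenomena.PercolationContinuityZ3.Theorems.PercNearOneGluingNoHeavyConstsSingleEdgeExtremal
import HarnessLib

/-!
# Single-edge extremality at the pair functionals FORCES the single-edge chain rule (the converse transfer)
# (PAPER-2 track (ii): constants of the CSH family)

builds on p205010 (kernel theorem, internal audit signed; external expert review pending).  Support file (`--supports
stmt-CriticalPhenomena-4575`), seat `prim-consts-2` (gen 3); rows A6/A11 of `run/shared/lean/prim/consts/CONSTANTS.md`; memo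
`run/shared/lean/prim/consts/FROM-prim-consts-2-g3-CHAIN-RULE.md` §1(C)(iv).  No definitions, no sorries; standard axioms.

`Consts.see_pairOpen_of_chainRule` showed: chain rule for `(G − xu; x,u,v,o,Y)` ⟹ SEE of `G` at `f = 1{s(x,u) ∈ 𝐂_x}` for every weight of the pair.
Here the EXACT identity behind it and the converse:

* `Consts.see_pairOpen_margin_eq` — for any weights, the SEE margin at `1{s(x,u) ∈ 𝐂_x}` equals `q(1−q)(q d₂ + (1−q) d₁)·[q T₁ + (1−q) T₂]`
  (`q = w_{s(x,u)}`; `T₁` = the chain-rule slack of the pair-deleted law, `T₂` = its weak form; all other symbols pair-deleted probabilities).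
* `Consts.chainRule_of_see_pairOpen` — if the SEE margin at `1{s(x,u) ∈ 𝐂_x}` is nonnegative for EVERY weight `q ∈ (0,1)` of the pair (all other
  weights fixed, `< 1`; `x ≠ u`; `x ∉ Y`), then the chain rule holds for the pair-deleted law: `T₁ ≥ 0` (an affine function of `q`
  nonnegative on `(0,1)` is nonnegative at `q = 1`).
* `Consts.SingleEdgeExtremal.chainRule` — hence the conjecture `Consts.SingleEdgeExtremal` implies the conjecture `Consts.SingleEdgeChainRule` at all
  non-degenerate pair-deleted data: the two typed conjectures AGREE on single-pair functionals, and an exact census of the chain rule (three source-set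
  probabilities per placement) is a falsification test for SEE.
[cite: VandenbergHaggstromKahn2005, Thm. 1.1 (pp. 3–5)]
-/

noncomputable section

namespace Summit.CriticalPhenomena.PercolationContinuityZ3.Theorems

open MeasureTheory Set Literature.Probability.LatticeModels Literature.Probability.Percolation
open scoped Classical

namespace Consts

variable {V : Type*} [Fintype V]

/-- **The single-edge-extremality margin at a pair functional, exactly.**  Owner `x`, a vertex `u ≠ x`, observers `o, v`, avoided set `Y`,
any weights `w` (`μ = prodBernoulli w`, `q = w_{s(x,u)}`, `μ₀` the law with the pair `s(x,u)` switched off).  With the `μ₀`-quantities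
`d₁ = μ₀(R₁)`, `d₂ = μ₀(R₂)`, `d₃ = μ₀(R₃)`, `d_{xv} = μ₀(R_{xv})`, `a_i = μ₀(R_i ∩ {o ∈ C_{S_i}})`, `a_{xv}`, `n_i = μ₀(R_i ∩ {v ∉ C_{S_i}})`
(`S₁ = {x}`, `S₂ = {x,u}`, `S₃ = {x,u,v}`, `R_S = {S ↮ Y}`), the margin of `Consts.SingleEdgeExtremal` at `f = 1{s(x,u) ∈ 𝐂_x}` equals
`q (1−q) (q d₂ + (1−q) d₁) · [ q · T₁ + (1−q) · T₂ ]`, `T₁ = (n₁a₂ − n₂a₁) d₃ − (n₁d₂ − n₂d₁) a₃` (the chain-rule slack of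
`Consts.SingleEdgeChainRule` for `μ₀`) and `T₂ = (n₁a₂ − n₂a₁) d_{xv} − (n₁d₂ − n₂d₁) a_{xv}` (its weak form).  Ingredients: the closed forms
`Consts.covD_pairOpen_eq` and pinning of the pair in the four `μ`-quantities (`Consts.real_split_pair`). [folklore] -/
theorem see_pairOpen_margin_eq (w : Sym2 V → unitInterval) (x u v o : V) (Y : Set V) (hxu : x ≠ u) :
    CSH.covD w x Y (fun C => if s(x, u) ∈ C then (1 : ℝ) else 0) o *
        ((prodBernoulli w).real {ω : BondConfig V | ∀ y ∈ Y, ¬ (openGraph ω).Reachable x y ∧ ¬ (openGraph ω).Reachable v y} *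
          (prodBernoulli w).real ({ω : BondConfig V | ∀ y ∈ Y, ¬ (openGraph ω).Reachable x y} ∩ {ω | ¬ (openGraph ω).Reachable x v})) -
      CSH.covD w x Y (fun C => if s(x, u) ∈ C then (1 : ℝ) else 0) v *
        ((prodBernoulli w).real {ω : BondConfig V | ∀ y ∈ Y, ¬ (openGraph ω).Reachable x y} *
            (prodBernoulli w).real ({ω : BondConfig V | ∀ y ∈ Y, ¬ (openGraph ω).Reachable x y ∧ ¬ (openGraph ω).Reachable v y} ∩ (openConn x o ∪ openConn v o)) -
          (prodBernoulli w).real {ω : BondConfig V | ∀ y ∈ Y, ¬ (openGraph ω).Reachable x y ∧ ¬ (openGraph ω).Reachable v y} *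
            (prodBernoulli w).real ({ω : BondConfig V | ∀ y ∈ Y, ¬ (openGraph ω).Reachable x y} ∩ openConn x o)) =
      (w s(x, u) : ℝ) * (1 - (w s(x, u) : ℝ)) *
        ((w s(x, u) : ℝ) * (prodBernoulli fun d => if d = s(x, u) then 0 else w d).real
            {ω : BondConfig V | ∀ y ∈ Y, ¬ (openGraph ω).Reachable x y ∧ ¬ (openGraph ω).Reachable u y} +
          (1 - (w s(x, u) : ℝ)) * (prodBernoulli fun d => if d = s(x, u) then 0 else w d).real
            {ω : BondConfig V | ∀ y ∈ Y, ¬ (openGraph ω).Reachable x y}) *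
        ((w s(x, u) : ℝ) *
            (((prodBernoulli fun d => if d = s(x, u) then 0 else w d).real
            ({ω : BondConfig V | ∀ y ∈ Y, ¬ (openGraph ω).Reachable x y} ∩ {ω | ¬ (openGraph ω).Reachable x v}) *
                (prodBernoulli fun d => if d = s(x, u) then 0 else w d).real
            ({ω : BondConfig V | ∀ y ∈ Y, ¬ (openGraph ω).Reachable x y ∧ ¬ (openGraph ω).Reachable u y} ∩
              (openConn x o ∪ openConn u o)) -
              (prodBernoulli fun d => if d = s(x, u) then 0 else w d).real
            ({ω : BondConfig V | ∀ y ∈ Y, ¬ (openGraph ω).Reachable x y ∧ ¬ (openGraph ω).Reachable u y} ∩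
              {ω | ¬ (openGraph ω).Reachable x v ∧ ¬ (openGraph ω).Reachable u v}) *
                (prodBernoulli fun d => if d = s(x, u) then 0 else w d).real
            ({ω : BondConfig V | ∀ y ∈ Y, ¬ (openGraph ω).Reachable x y} ∩ openConn x o)) *
              (prodBernoulli fun d => if d = s(x, u) then 0 else w d).real
            {ω : BondConfig V | ∀ y ∈ Y, ¬ (openGraph ω).Reachable x y ∧ ¬ (openGraph ω).Reachable u y ∧
                  ¬ (openGraph ω).Reachable v y} -
            ((prodBernoulli fun d => if d = s(x, u) then 0 else w d).real
            ({ω : BondConfig V | ∀ y ∈ Y, ¬ (openGraph ω).Reachable x y} ∩ {ω | ¬ (openGraph ω).Reachable x v}) *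
                (prodBernoulli fun d => if d = s(x, u) then 0 else w d).real
            {ω : BondConfig V | ∀ y ∈ Y, ¬ (openGraph ω).Reachable x y ∧ ¬ (openGraph ω).Reachable u y} -
              (prodBernoulli fun d => if d = s(x, u) then 0 else w d).real
            ({ω : BondConfig V | ∀ y ∈ Y, ¬ (openGraph ω).Reachable x y ∧ ¬ (openGraph ω).Reachable u y} ∩
              {ω | ¬ (openGraph ω).Reachable x v ∧ ¬ (openGraph ω).Reachable u v}) *
                (prodBernoulli fun d => if d = s(x, u) then 0 else w d).real
            {ω : BondConfig V | ∀ y ∈ Y, ¬ (openGraph ω).Reachable x y}) *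
              (prodBernoulli fun d => if d = s(x, u) then 0 else w d).real
            ({ω : BondConfig V | ∀ y ∈ Y, ¬ (openGraph ω).Reachable x y ∧ ¬ (openGraph ω).Reachable u y ∧
                  ¬ (openGraph ω).Reachable v y} ∩ (openConn x o ∪ openConn u o ∪ openConn v o))) +
          (1 - (w s(x, u) : ℝ)) *
            (((prodBernoulli fun d => if d = s(x, u) then 0 else w d).real
            ({ω : BondConfig V | ∀ y ∈ Y, ¬ (openGraph ω).Reachable x y} ∩ {ω | ¬ (openGraph ω).Reachable x v}) *
                (prodBernoulli fun d => if d = s(x, u) then 0 else w d).real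
            ({ω : BondConfig V | ∀ y ∈ Y, ¬ (openGraph ω).Reachable x y ∧ ¬ (openGraph ω).Reachable u y} ∩
              (openConn x o ∪ openConn u o)) -
              (prodBernoulli fun d => if d = s(x, u) then 0 else w d).real
            ({ω : BondConfig V | ∀ y ∈ Y, ¬ (openGraph ω).Reachable x y ∧ ¬ (openGraph ω).Reachable u y} ∩
              {ω | ¬ (openGraph ω).Reachable x v ∧ ¬ (openGraph ω).Reachable u v}) *
                (prodBernoulli fun d => if d = s(x, u) then 0 else w d).real
            ({ω : BondConfig V | ∀ y ∈ Y, ¬ (openGraph ω).Reachable x y} ∩ openConn x o)) *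
              (prodBernoulli fun d => if d = s(x, u) then 0 else w d).real
            {ω : BondConfig V | ∀ y ∈ Y, ¬ (openGraph ω).Reachable x y ∧ ¬ (openGraph ω).Reachable v y} -
            ((prodBernoulli fun d => if d = s(x, u) then 0 else w d).real
            ({ω : BondConfig V | ∀ y ∈ Y, ¬ (openGraph ω).Reachable x y} ∩ {ω | ¬ (openGraph ω).Reachable x v}) *
                (prodBernoulli fun d => if d = s(x, u) then 0 else w d).real
            {ω : BondConfig V | ∀ y ∈ Y, ¬ (openGraph ω).Reachable x y ∧ ¬ (openGraph ω).Reachable u y} -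
              (prodBernoulli fun d => if d = s(x, u) then 0 else w d).real
            ({ω : BondConfig V | ∀ y ∈ Y, ¬ (openGraph ω).Reachable x y ∧ ¬ (openGraph ω).Reachable u y} ∩
              {ω | ¬ (openGraph ω).Reachable x v ∧ ¬ (openGraph ω).Reachable u v}) *
                (prodBernoulli fun d => if d = s(x, u) then 0 else w d).real
            {ω : BondConfig V | ∀ y ∈ Y, ¬ (openGraph ω).Reachable x y}) *
              (prodBernoulli fun d => if d = s(x, u) then 0 else w d).real
            ({ω : BondConfig V | ∀ y ∈ Y, ¬ (openGraph ω).Reachable x y ∧ ¬ (openGraph ω).Reachable v y} ∩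
              (openConn x o ∪ openConn v o)))) := by
  classical
  set e : Sym2 V := s(x, u) with he_def
  set μ := prodBernoulli w with hμ
  set w₀ : Sym2 V → unitInterval := fun d => if d = e then 0 else w d with hw₀
  set μ₀ := prodBernoulli w₀ with hμ₀
  have hmeas : ∀ T : Set (BondConfig V), MeasurableSet T := fun _ => MeasurableSet.of_discrete
  -- events (the same sets under `μ` and `μ₀`)
  set R1 : Set (BondConfig V) := {ω | ∀ y ∈ Y, ¬ (openGraph ω).Reachable x y} with hR1
  set R2 : Set (BondConfig V) := {ω | ∀ y ∈ Y, ¬ (openGraph ω).Reachable x y ∧ ¬ (openGraph ω).Reachable u y} with hR2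
  set R3 : Set (BondConfig V) :=
    {ω | ∀ y ∈ Y, ¬ (openGraph ω).Reachable x y ∧ ¬ (openGraph ω).Reachable u y ∧ ¬ (openGraph ω).Reachable v y} with hR3
  set Rxv : Set (BondConfig V) := {ω | ∀ y ∈ Y, ¬ (openGraph ω).Reachable x y ∧ ¬ (openGraph ω).Reachable v y} with hRxv
  set Oo : Set (BondConfig V) := openConn x o ∪ openConn u o ∪ openConn v o with hOo
  set Oxu : Set (BondConfig V) := openConn x o ∪ openConn u o with hOxu
  set Oxv : Set (BondConfig V) := openConn x o ∪ openConn v o with hOxv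
  set Nx : Set (BondConfig V) := {ω | ¬ (openGraph ω).Reachable x v} with hNx
  set Nxu : Set (BondConfig V) := {ω | ¬ (openGraph ω).Reachable x v ∧ ¬ (openGraph ω).Reachable u v} with hNxu
  -- the μ₀-numbers
  set d1 : ℝ := μ₀.real R1 with hd1
  set d2 : ℝ := μ₀.real R2 with hd2
  set d3 : ℝ := μ₀.real R3 with hd3
  set dxv : ℝ := μ₀.real Rxv with hdxv
  set a1 : ℝ := μ₀.real (R1 ∩ openConn x o) with ha1
  set a2 : ℝ := μ₀.real (R2 ∩ Oxu) with ha2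
  set a3 : ℝ := μ₀.real (R3 ∩ Oo) with ha3
  set axv : ℝ := μ₀.real (Rxv ∩ Oxv) with haxv
  set n1 : ℝ := μ₀.real (R1 ∩ Nx) with hn1
  set n2 : ℝ := μ₀.real (R2 ∩ Nxu) with hn2
  set q : ℝ := (w e : ℝ) with hq
  -- (1) the covariances in closed form
  have hco : CSH.covD w x Y (fun C => if s(x, u) ∈ C then (1 : ℝ) else 0) o = q * (1 - q) * (d1 * a2 - d2 * a1) := by
    rw [covD_pairOpen_eq w x u o Y hxu]
  have hB1 : μ₀.real (R1 ∩ openConn x v) = d1 - n1 := by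
    have h := measureReal_inter_add_sdiff (μ := μ₀) (s := R1) (hmeas (openConn x v))
    have hset : R1 \ openConn x v = R1 ∩ Nx := rfl
    rw [hset] at h; linarith
  have hB2 : μ₀.real (R2 ∩ (openConn x v ∪ openConn u v)) = d2 - n2 := by
    have h := measureReal_inter_add_sdiff (μ := μ₀) (s := R2) (hmeas (openConn x v ∪ openConn u v))
    have hset : R2 \ (openConn x v ∪ openConn u v) = R2 ∩ Nxu := by
      ext ω; simp only [hNxu, mem_sdiff, mem_inter_iff, mem_union, mem_setOf_eq, openConn, not_or]
    rw [hset] at h; linarith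
  have hcv : CSH.covD w x Y (fun C => if s(x, u) ∈ C then (1 : ℝ) else 0) v = q * (1 - q) * (d2 * n1 - d1 * n2) := by
    rw [covD_pairOpen_eq w x u v Y hxu]
    change q * (1 - q) * (d1 * μ₀.real (R2 ∩ (openConn x v ∪ openConn u v)) - d2 * μ₀.real (R1 ∩ openConn x v)) = _
    rw [hB1, hB2]; ring
  -- (2) pinning `e` in the four `μ`-quantities of the margin
  have pinR1 : μ.real R1 = q * d2 + (1 - q) * d1 := by
    refine real_split_pair w e R1 R2 (fun ω heω => ?_)
    simp only [hR1, hR2, mem_setOf_eq]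
    exact avoid_iff_sdiff_pair Y heω
  have pinA1 : μ.real (R1 ∩ openConn x o) = q * a2 + (1 - q) * a1 := by
    refine real_split_pair w e (R1 ∩ openConn x o) (R2 ∩ Oxu) (fun ω heω => ?_)
    simp only [hR1, hR2, hOxu, mem_inter_iff, mem_setOf_eq, mem_union, openConn]
    rw [avoid_iff_sdiff_pair Y heω, CSH.reachable_iff_sdiff_pair o heω]
  have pinN1 : μ.real (R1 ∩ Nx) = q * n2 + (1 - q) * n1 := by
    refine real_split_pair w e (R1 ∩ Nx) (R2 ∩ Nxu) (fun ω heω => ?_)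
    simp only [hR1, hR2, hNx, hNxu, mem_inter_iff, mem_setOf_eq]
    rw [avoid_iff_sdiff_pair Y heω, CSH.reachable_iff_sdiff_pair v heω, not_or]
  -- reachability from the third vertex `v` with `e` open
  have hins : ∀ ω : BondConfig V, e ∈ ω → insert s(x, u) (ω \ {e}) = ω := fun ω heω => by
    rw [he_def, Set.insert_sdiff_singleton, Set.insert_eq_of_mem heω]
  have reach_v : ∀ ω : BondConfig V, e ∈ ω → ∀ t : V,
      (openGraph ω).Reachable v t ↔
        (openGraph (ω \ {e})).Reachable v t ∨
          ((openGraph (ω \ {e})).Reachable v x ∧ (openGraph (ω \ {e})).Reachable u t) ∨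
          ((openGraph (ω \ {e})).Reachable v u ∧ (openGraph (ω \ {e})).Reachable x t) := by
    intro ω heω t
    have key := KNSep.reachable_insert_iff (ω \ {e}) x u v t
    rwa [hins ω heω] at key
  have pinRxv : μ.real Rxv = q * d3 + (1 - q) * dxv := by
    refine real_split_pair w e Rxv R3 (fun ω heω => ?_)
    simp only [hRxv, hR3, mem_setOf_eq]
    have hav := avoid_iff_sdiff_pair (x := x) (v := u) Y heω
    constructor
    · intro h y hy
      have hxu' := (hav.1 (fun y' hy' => (h y' hy').1)) y hy
      refine ⟨hxu'.1, hxu'.2, fun hvy => (h y hy).2 ?_⟩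
      exact (reach_v ω heω y).2 (Or.inl hvy)
    · intro h y hy
      refine ⟨(hav.2 (fun y' hy' => ⟨(h y' hy').1, (h y' hy').2.1⟩)) y hy, fun hvy => ?_⟩
      rcases (reach_v ω heω y).1 hvy with h1 | ⟨-, h2⟩ | ⟨-, h3⟩
      · exact (h y hy).2.2 h1
      · exact (h y hy).2.1 h2
      · exact (h y hy).1 h3
  have pinAxv : μ.real (Rxv ∩ Oxv) = q * a3 + (1 - q) * axv := by
    refine real_split_pair w e (Rxv ∩ Oxv) (R3 ∩ Oo) (fun ω heω => ?_)
    have hav := avoid_iff_sdiff_pair (x := x) (v := u) Y heω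
    simp only [hRxv, hR3, hOxv, hOo, mem_inter_iff, mem_setOf_eq, mem_union, openConn]
    constructor
    · rintro ⟨h, hO⟩
      refine ⟨fun y hy => ?_, ?_⟩
      · have hxu' := (hav.1 (fun y' hy' => (h y' hy').1)) y hy
        exact ⟨hxu'.1, hxu'.2, fun hvy => (h y hy).2 ((reach_v ω heω y).2 (Or.inl hvy))⟩
      · rcases hO with hxo | hvo
        · rcases (CSH.reachable_iff_sdiff_pair o heω).1 hxo with h1 | h2
          · exact Or.inl (Or.inl h1)
          · exact Or.inl (Or.inr h2)
        · rcases (reach_v ω heω o).1 hvo with h1 | ⟨-, h2⟩ | ⟨-, h3⟩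
          · exact Or.inr h1
          · exact Or.inl (Or.inr h2)
          · exact Or.inl (Or.inl h3)
    · rintro ⟨h, hO⟩
      refine ⟨fun y hy => ⟨(hav.2 (fun y' hy' => ⟨(h y' hy').1, (h y' hy').2.1⟩)) y hy, fun hvy => ?_⟩, ?_⟩
      · rcases (reach_v ω heω y).1 hvy with h1 | ⟨-, h2⟩ | ⟨-, h3⟩
        · exact (h y hy).2.2 h1
        · exact (h y hy).2.1 h2
        · exact (h y hy).1 h3
      · rcases hO with (hxo | huo) | hvo
        · exact Or.inl ((CSH.reachable_iff_sdiff_pair o heω).2 (Or.inl hxo))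
        · exact Or.inl ((CSH.reachable_iff_sdiff_pair o heω).2 (Or.inr huo))
        · exact Or.inr ((reach_v ω heω o).2 (Or.inl hvo))
  -- assemble
  rw [hco, hcv, pinR1, pinA1, pinN1, pinRxv, pinAxv]
  ring

/-- If `q T₁ + (1 − q) T₂ ≥ 0` for all `q ∈ (0,1)` then `T₁ ≥ 0`. [folklore] -/
theorem nonneg_of_forall_affine_nonneg {T₁ T₂ : ℝ} (h : ∀ q : ℝ, 0 < q → q < 1 → 0 ≤ q * T₁ + (1 - q) * T₂) : 0 ≤ T₁ := by
  by_contra hT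
  push Not at hT
  by_cases hT2 : T₂ ≤ 0
  · have h12 := h (1 / 2) (by norm_num) (by norm_num)
    linarith
  · push Not at hT2
    set D : ℝ := T₂ - T₁ with hD
    have hDpos : 0 < D := by rw [hD]; linarith
    set r : ℝ := -T₁ / (2 * D) with hr
    have hr0 : 0 < r := div_pos (by linarith) (by linarith)
    have hr1 : r < 1 := by
      rw [hr, div_lt_one (by linarith)]; linarith
    have hrD : r * (2 * D) = -T₁ := by rw [hr]; field_simp
    have hval : (1 - r) * T₁ + (1 - (1 - r)) * T₂ = T₁ + r * D := by rw [hD]; ring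
    have := h (1 - r) (by linarith) (by linarith)
    rw [hval] at this
    nlinarith

/-- **THEOREM — SEE at the pair functional for all weights of the pair forces the chain rule.**  Owner `x`, `u ≠ x`, observers `o, v`,
`Y ∌ x`, weights `w < 1`.  If for EVERY weight `q ∈ (0,1)` of the pair `s(x,u)` (all other weights those of `w`) the single-edge-extremality
margin (the inequality of `Consts.SingleEdgeExtremal`) is nonnegative at `f = 1{s(x,u) ∈ 𝐂_x}`, then the single-edge chain rule (the inequality of
`Consts.SingleEdgeChainRule`) holds for the pair-deleted law `μ₀`.  By `Consts.see_pairOpen_margin_eq` the margin is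
`q(1−q)(q d₂ + (1−q) d₁)[q T₁ + (1−q) T₂]` with `d₁ > 0`; nonnegativity for all `q ∈ (0,1)` gives `T₁ ≥ 0`. [cite: VandenbergHaggstromKahn2005, Thm. 1.1 (pp. 3–5)] -/
theorem chainRule_of_see_pairOpen (w : Sym2 V → unitInterval) (hw : ∀ d, w d < 1) (x u v o : V) (Y : Set V) (hxu : x ≠ u)
    (hx : x ∉ Y)
    (hSEE : ∀ (q : ℝ) (hq0 : 0 < q) (hq1 : q < 1),
        CSH.covD (fun d => if d = s(x, u) then (⟨q, hq0.le, hq1.le⟩ : unitInterval) else w d) x Y (fun C => if s(x, u) ∈ C then (1 : ℝ) else 0) v *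
            ((prodBernoulli (fun d => if d = s(x, u) then (⟨q, hq0.le, hq1.le⟩ : unitInterval) else w d)).real {ω : BondConfig V | ∀ y ∈ Y, ¬ (openGraph ω).Reachable x y} *
                (prodBernoulli (fun d => if d = s(x, u) then (⟨q, hq0.le, hq1.le⟩ : unitInterval) else w d)).real
                  ({ω : BondConfig V | ∀ y ∈ Y, ¬ (openGraph ω).Reachable x y ∧ ¬ (openGraph ω).Reachable v y} ∩ (openConn x o ∪ openConn v o)) -
              (prodBernoulli (fun d => if d = s(x, u) then (⟨q, hq0.le, hq1.le⟩ : unitInterval) else w d)).real {ω : BondConfig V | ∀ y ∈ Y, ¬ (openGraph ω).Reachable x y ∧ ¬ (openGraph ω).Reachable v y} *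
                (prodBernoulli (fun d => if d = s(x, u) then (⟨q, hq0.le, hq1.le⟩ : unitInterval) else w d)).real ({ω : BondConfig V | ∀ y ∈ Y, ¬ (openGraph ω).Reachable x y} ∩ openConn x o)) ≤
          CSH.covD (fun d => if d = s(x, u) then (⟨q, hq0.le, hq1.le⟩ : unitInterval) else w d) x Y (fun C => if s(x, u) ∈ C then (1 : ℝ) else 0) o *
            ((prodBernoulli (fun d => if d = s(x, u) then (⟨q, hq0.le, hq1.le⟩ : unitInterval) else w d)).real {ω : BondConfig V | ∀ y ∈ Y, ¬ (openGraph ω).Reachable x y ∧ ¬ (openGraph ω).Reachable v y} *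
              (prodBernoulli (fun d => if d = s(x, u) then (⟨q, hq0.le, hq1.le⟩ : unitInterval) else w d)).real ({ω : BondConfig V | ∀ y ∈ Y, ¬ (openGraph ω).Reachable x y} ∩ {ω | ¬ (openGraph ω).Reachable x v}))) :
    (prodBernoulli fun d => if d = s(x, u) then 0 else w d).real
            ({ω : BondConfig V | ∀ y ∈ Y, ¬ (openGraph ω).Reachable x y} ∩ {ω | ¬ (openGraph ω).Reachable x v}) *
          ((prodBernoulli fun d => if d = s(x, u) then 0 else w d).real
                ({ω : BondConfig V | ∀ y ∈ Y, ¬ (openGraph ω).Reachable x y ∧ ¬ (openGraph ω).Reachable u y ∧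
                  ¬ (openGraph ω).Reachable v y} ∩ (openConn x o ∪ openConn u o ∪ openConn v o)) *
              (prodBernoulli fun d => if d = s(x, u) then 0 else w d).real
                {ω : BondConfig V | ∀ y ∈ Y, ¬ (openGraph ω).Reachable x y ∧ ¬ (openGraph ω).Reachable u y} -
            (prodBernoulli fun d => if d = s(x, u) then 0 else w d).real
                ({ω : BondConfig V | ∀ y ∈ Y, ¬ (openGraph ω).Reachable x y ∧ ¬ (openGraph ω).Reachable u y} ∩
                  (openConn x o ∪ openConn u o)) *
              (prodBernoulli fun d => if d = s(x, u) then 0 else w d).real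
                {ω : BondConfig V | ∀ y ∈ Y, ¬ (openGraph ω).Reachable x y ∧ ¬ (openGraph ω).Reachable u y ∧
                  ¬ (openGraph ω).Reachable v y}) ≤
        (prodBernoulli fun d => if d = s(x, u) then 0 else w d).real
            ({ω : BondConfig V | ∀ y ∈ Y, ¬ (openGraph ω).Reachable x y ∧ ¬ (openGraph ω).Reachable u y} ∩
              {ω | ¬ (openGraph ω).Reachable x v ∧ ¬ (openGraph ω).Reachable u v}) *
          ((prodBernoulli fun d => if d = s(x, u) then 0 else w d).real
                ({ω : BondConfig V | ∀ y ∈ Y, ¬ (openGraph ω).Reachable x y ∧ ¬ (openGraph ω).Reachable u y ∧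
                  ¬ (openGraph ω).Reachable v y} ∩ (openConn x o ∪ openConn u o ∪ openConn v o)) *
              (prodBernoulli fun d => if d = s(x, u) then 0 else w d).real
                {ω : BondConfig V | ∀ y ∈ Y, ¬ (openGraph ω).Reachable x y} -
            (prodBernoulli fun d => if d = s(x, u) then 0 else w d).real
                ({ω : BondConfig V | ∀ y ∈ Y, ¬ (openGraph ω).Reachable x y} ∩ openConn x o) *
              (prodBernoulli fun d => if d = s(x, u) then 0 else w d).real
                {ω : BondConfig V | ∀ y ∈ Y, ¬ (openGraph ω).Reachable x y ∧ ¬ (openGraph ω).Reachable u y ∧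
                  ¬ (openGraph ω).Reachable v y}) := by
  classical
  set e : Sym2 V := s(x, u) with he_def
  set w₀ : Sym2 V → unitInterval := fun d => if d = e then 0 else w d with hw₀
  set μ₀ := prodBernoulli w₀ with hμ₀
  set R1 : Set (BondConfig V) := {ω : BondConfig V | ∀ y ∈ Y, ¬ (openGraph ω).Reachable x y} with hR1
  set R2 : Set (BondConfig V) := {ω : BondConfig V | ∀ y ∈ Y, ¬ (openGraph ω).Reachable x y ∧ ¬ (openGraph ω).Reachable u y} with hR2
  set R3 : Set (BondConfig V) :=
    {ω | ∀ y ∈ Y, ¬ (openGraph ω).Reachable x y ∧ ¬ (openGraph ω).Reachable u y ∧ ¬ (openGraph ω).Reachable v y} with hR3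
  set Rxv : Set (BondConfig V) := {ω : BondConfig V | ∀ y ∈ Y, ¬ (openGraph ω).Reachable x y ∧ ¬ (openGraph ω).Reachable v y} with hRxv
  set d1 : ℝ := μ₀.real R1 with hd1
  set d2 : ℝ := μ₀.real R2 with hd2
  set d3 : ℝ := μ₀.real R3 with hd3
  set dxv : ℝ := μ₀.real Rxv with hdxv
  set a1 : ℝ := μ₀.real (R1 ∩ openConn x o) with ha1
  set a2 : ℝ := μ₀.real (R2 ∩ (openConn x o ∪ openConn u o)) with ha2
  set a3 : ℝ := μ₀.real (R3 ∩ (openConn x o ∪ openConn u o ∪ openConn v o)) with ha3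
  set axv : ℝ := μ₀.real (Rxv ∩ (openConn x o ∪ openConn v o)) with haxv
  set n1 : ℝ := μ₀.real (R1 ∩ {ω | ¬ (openGraph ω).Reachable x v}) with hn1
  set n2 : ℝ := μ₀.real (R2 ∩ {ω | ¬ (openGraph ω).Reachable x v ∧ ¬ (openGraph ω).Reachable u v}) with hn2
  -- `d1 > 0`
  have hlt0 : ∀ d, w₀ d < 1 := fun d => by
    simp only [hw₀]; split_ifs
    · exact zero_lt_one
    · exact hw d
  have hbot : openGraph (∅ : BondConfig V) = ⊥ := by unfold openGraph; exact SimpleGraph.fromEdgeSet_empty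
  have hnoreach : ∀ a b : V, a ≠ b → ¬ (openGraph (∅ : BondConfig V)).Reachable a b := fun a b hab h => by
    rw [hbot, SimpleGraph.reachable_bot] at h; exact hab h
  have hd1p : 0 < d1 := CSH.prodBernoulli_real_pos_of_empty_mem w₀ hlt0 (fun y hy => hnoreach x y (fun h => hx (h ▸ hy)))
  have hd2n : 0 ≤ d2 := measureReal_nonneg
  -- the affine function `q T₁ + (1 − q) T₂` is nonnegative on `(0,1)`
  have haff : ∀ q : ℝ, 0 < q → q < 1 →
      0 ≤ q * ((n1 * a2 - n2 * a1) * d3 - (n1 * d2 - n2 * d1) * a3) + (1 - q) * ((n1 * a2 - n2 * a1) * dxv - (n1 * d2 - n2 * d1) * axv) := by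
    intro q hq0 hq1
    set wq : Sym2 V → unitInterval := fun d => if d = s(x, u) then (⟨q, hq0.le, hq1.le⟩ : unitInterval) else w d with hwq
    have hwq0 : (fun d => if d = s(x, u) then (0 : unitInterval) else wq d) = w₀ := by
      funext d
      simp only [hwq, hw₀, he_def]
      split_ifs <;> rfl
    have hwqe : ((wq s(x, u) : unitInterval) : ℝ) = q := by simp [hwq]
    have key := see_pairOpen_margin_eq wq x u v o Y hxu
    rw [hwq0, hwqe] at key
    have hm := hSEE q hq0 hq1
    have hmargin : 0 ≤ q * (1 - q) * (q * d2 + (1 - q) * d1) *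
        (q * ((n1 * a2 - n2 * a1) * d3 - (n1 * d2 - n2 * d1) * a3) +
          (1 - q) * ((n1 * a2 - n2 * a1) * dxv - (n1 * d2 - n2 * d1) * axv)) := by
      rw [← key]; linarith
    have hpos : 0 < q * (1 - q) * (q * d2 + (1 - q) * d1) :=
      mul_pos (mul_pos hq0 (by linarith)) (by nlinarith)
    by_contra hneg
    push Not at hneg
    have := mul_neg_of_pos_of_neg hpos hneg
    linarith
  have hT1 := nonneg_of_forall_affine_nonneg haff
  -- `T₁ ≥ 0` is the chain rule
  have h : n2 * (a3 * d1 - a1 * d3) - n1 * (a3 * d2 - a2 * d3) = (n1 * a2 - n2 * a1) * d3 - (n1 * d2 - n2 * d1) * a3 := by ring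
  have : 0 ≤ n2 * (a3 * d1 - a1 * d3) - n1 * (a3 * d2 - a2 * d3) := by rw [h]; exact hT1
  linarith

/-- **`Consts.SingleEdgeExtremal` implies `Consts.SingleEdgeChainRule` on all non-degenerate pair-deleted data.**  Under SEE, for every graph on
`Fin n` with weights `< 1`, `u ≠ x`, `x ∉ Y`, the chain-rule inequality holds for the law with the pair `s(x,u)` switched off
(`Consts.chainRule_of_see_pairOpen` with SEE supplying the margins at `1{s(x,u) ∈ 𝐂_x}`).  With `Consts.SingleEdgeChainRule.see_pairOpen`:
on single-pair functionals the two typed conjectures are equivalent. [cite: VandenbergHaggstromKahn2005, Thm. 1.1 (pp. 3–5)] -/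
theorem SingleEdgeExtremal.chainRule (hS : SingleEdgeExtremal) {n : ℕ} (w : Sym2 (Fin n) → unitInterval) (hw : ∀ d, w d < 1)
    (x u v o : Fin n) (Y : Set (Fin n)) (hxu : x ≠ u) (hx : x ∉ Y) :
    (prodBernoulli fun d => if d = s(x, u) then 0 else w d).real
            ({ω : BondConfig (Fin n) | ∀ y ∈ Y, ¬ (openGraph ω).Reachable x y} ∩ {ω | ¬ (openGraph ω).Reachable x v}) *
          ((prodBernoulli fun d => if d = s(x, u) then 0 else w d).real
                ({ω : BondConfig (Fin n) | ∀ y ∈ Y, ¬ (openGraph ω).Reachable x y ∧ ¬ (openGraph ω).Reachable u y ∧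
                  ¬ (openGraph ω).Reachable v y} ∩ (openConn x o ∪ openConn u o ∪ openConn v o)) *
              (prodBernoulli fun d => if d = s(x, u) then 0 else w d).real
                {ω : BondConfig (Fin n) | ∀ y ∈ Y, ¬ (openGraph ω).Reachable x y ∧ ¬ (openGraph ω).Reachable u y} -
            (prodBernoulli fun d => if d = s(x, u) then 0 else w d).real
                ({ω : BondConfig (Fin n) | ∀ y ∈ Y, ¬ (openGraph ω).Reachable x y ∧ ¬ (openGraph ω).Reachable u y} ∩
                  (openConn x o ∪ openConn u o)) *
              (prodBernoulli fun d => if d = s(x, u) then 0 else w d).real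
                {ω : BondConfig (Fin n) | ∀ y ∈ Y, ¬ (openGraph ω).Reachable x y ∧ ¬ (openGraph ω).Reachable u y ∧
                  ¬ (openGraph ω).Reachable v y}) ≤
        (prodBernoulli fun d => if d = s(x, u) then 0 else w d).real
            ({ω : BondConfig (Fin n) | ∀ y ∈ Y, ¬ (openGraph ω).Reachable x y ∧ ¬ (openGraph ω).Reachable u y} ∩
              {ω | ¬ (openGraph ω).Reachable x v ∧ ¬ (openGraph ω).Reachable u v}) *
          ((prodBernoulli fun d => if d = s(x, u) then 0 else w d).real
                ({ω : BondConfig (Fin n) | ∀ y ∈ Y, ¬ (openGraph ω).Reachable x y ∧ ¬ (openGraph ω).Reachable u y ∧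
                  ¬ (openGraph ω).Reachable v y} ∩ (openConn x o ∪ openConn u o ∪ openConn v o)) *
              (prodBernoulli fun d => if d = s(x, u) then 0 else w d).real
                {ω : BondConfig (Fin n) | ∀ y ∈ Y, ¬ (openGraph ω).Reachable x y} -
            (prodBernoulli fun d => if d = s(x, u) then 0 else w d).real
                ({ω : BondConfig (Fin n) | ∀ y ∈ Y, ¬ (openGraph ω).Reachable x y} ∩ openConn x o) *
              (prodBernoulli fun d => if d = s(x, u) then 0 else w d).real
                {ω : BondConfig (Fin n) | ∀ y ∈ Y, ¬ (openGraph ω).Reachable x y ∧ ¬ (openGraph ω).Reachable u y ∧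
                  ¬ (openGraph ω).Reachable v y}) := by
  classical
  have hf : Monotone (fun C : Set (Sym2 (Fin n)) => if s(x, u) ∈ C then (1 : ℝ) else 0) :=
    TripodExchange.predIndicator_monotone (fun C C' hCC' h => hCC' h)
  have key := chainRule_of_see_pairOpen w hw x u v o Y hxu hx (fun q hq0 hq1 => by
    convert hS n (fun d => if d = s(x, u) then (⟨q, hq0.le, hq1.le⟩ : unitInterval) else w d) x o v Y _ hf)
  convert key

end Consts

end Summit.CriticalPhenomena.PercolationContinuityZ3.Theorems

end
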